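import Mathlib.Data.List.Perm.Subperm
import Mathlib.Algebra.Order.BigOperators.Group.List
import Literature.Topology.PlaneTopology.RectilinearLoopCorners
import HarnessLib

/-!
# The rectilinear Umlaufsatz: a lattice loop turns by `±4` quarter turns

Topic `Literature/Topology/PlaneTopology`; last file of the development
(`RectilinearLoops.lean`, `RectilinearLoopMoves.lean`, `RectilinearLoopCorners.lean`). Main
result `RectLoop.IsLoop.cycTurn_eq`: for every rectilinear lattice loop `l` (at least three
distinct points of `ℤ²`, cyclically adjacent), `cycTurn l = 4 ∨ cycTurn l = -4` — the polygonal
case of Hopf's Umlaufsatz (H. Hopf, Compositio Math. 2 (1935), Satz I: the tangent of a simple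
closed plane curve turns by `±2π`) for orthogonal lattice polygons, equivalently "an orthogonal
polygon has four more convex than reflex vertices". [cite: Hopf1935, Satz I]

Proof (combinatorial): strong induction on the length and then on the potential `height B`
(total height above a fixed level `B` below the loop). Loops of length `3` do not exist and loops
of length `4` turn by `±4`. For a longer loop start at the top-left vertex, a corner of type
`{e₀, -e₁}` (`cornerAt_topleft`), and walk along the diagonal `q + k(e₀ - e₁)`: at a corner `v`
of this type with opposite cell corner `v'` (`exists_move_or_cornerAt`) either a
turning-preserving move of `RectilinearLoopMoves.lean` applies — the flip if `v'` is free (same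
length, potential one less), a shortcut if `v'` is two steps from `v` along the loop (length two
less) — and the induction hypothesis finishes, or `v'` is the next corner of the same type
(`cornerAt_next`). The walk cannot go on for more than `length` steps (the diagonal points are
distinct vertices of the loop: pigeonhole), so a move eventually applies.
-/

namespace Literature.Topology.PlaneTopology

namespace RectLoop

open List

-- The property proved by induction, as a local notation: the loop `l` turns by `±4`.
local notation "P" l:max => (cycTurn l = 4 ∨ cycTurn l = -4)

/-- A nonempty list is a prefix followed by its last element. [folklore] -/
theorem exists_eq_append_singleton {α : Type*} (a : α) (l : List α) : ∃ A z, a :: l = A ++ [z] := by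
  induction l generalizing a with
  | nil => exact ⟨[], a, rfl⟩
  | cons b l ih =>
    obtain ⟨A, z, h⟩ := ih b
    exact ⟨a :: A, z, by rw [cons_append, ← h]⟩

/-- **One step of the walk.** At a corner `v` of type `{e₀, -e₁}` of a loop `l` with at least five
vertices, all at height `≥ B`: either there is a loop `l'` with the same turning parity class
(`P l' → P l`), all vertices at height `≥ B`, and smaller measure (two vertices fewer, or as many
vertices and smaller `height B`), or the opposite cell corner `v + e₀ - e₁` is again a corner of
type `{e₀, -e₁}`. [folklore] -/
theorem exists_move_or_cornerAt {l : List (ℤ × ℤ)} (hl : IsLoop l) {v : ℤ × ℤ} (hv : CornerAt l v)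
    (B : ℤ) (hB : ∀ p ∈ l, B ≤ p.2) :
    (∃ l', IsLoop l' ∧ (P l' → P l) ∧
        (l'.length + 2 = l.length ∨ (l'.length = l.length ∧ height B l' < height B l)) ∧
        ∀ p ∈ l', B ≤ p.2) ∨
      CornerAt l (v + dir 0 + dir 3) := by
  obtain ⟨x₀, x₁, x₃, x₄, R, hrot, h13⟩ := hv
  have hL : IsLoop (x₀ :: x₁ :: v :: x₃ :: x₄ :: R) := by
    obtain ⟨n, hn⟩ := hrot; exact hn ▸ hl.rotate n
  have hcyc : cycTurn (x₀ :: x₁ :: v :: x₃ :: x₄ :: R) = cycTurn l := cycTurn_eq_of_isRotated hrot hl.three_le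
  have hmemL : ∀ p, p ∈ x₀ :: x₁ :: v :: x₃ :: x₄ :: R ↔ p ∈ l := fun p => (hrot.mem_iff).symm
  have hlenL : (x₀ :: x₁ :: v :: x₃ :: x₄ :: R).length = l.length := hrot.perm.length_eq.symm
  have hhtL : height B (x₀ :: x₁ :: v :: x₃ :: x₄ :: R) = height B l := height_eq_of_perm hrot.perm.symm
  have hBL : ∀ p ∈ x₀ :: x₁ :: v :: x₃ :: x₄ :: R, B ≤ p.2 := fun p hp => hB p ((hmemL p).1 hp)
  have hv' : x₁ + x₃ - v = v + dir 0 + dir 3 := by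
    rcases h13 with ⟨e1, e3⟩ | ⟨e1, e3⟩ <;> rw [e1, e3] <;> abel
  have hab : cross (x₁ - v) (x₃ - v) ≠ 0 := by
    rcases h13 with ⟨e1, e3⟩ | ⟨e1, e3⟩ <;> rw [e1, e3] <;> simp [cross, dir]
  have hdown : B + 1 ≤ v.2 := by
    have : v + dir 3 ∈ x₀ :: x₁ :: v :: x₃ :: x₄ :: R := by
      rcases h13 with ⟨-, e3⟩ | ⟨e1, -⟩
      · rw [← e3]; simp
      · rw [← e1]; simp
    have := hBL _ this
    simp [dir] at this
    omega
  by_cases hmem : v + dir 0 + dir 3 ∈ x₀ :: x₁ :: v :: x₃ :: x₄ :: R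
  · by_cases h0 : v + dir 0 + dir 3 = x₀
    · -- backward shortcut, in the window `z :: x₀ :: x₁ :: v :: x₃ :: A`
      left
      obtain ⟨A, z, hA⟩ := exists_eq_append_singleton x₄ R
      have hrot2 : (x₀ :: x₁ :: v :: x₃ :: x₄ :: R) ~r (z :: x₀ :: x₁ :: v :: x₃ :: A) := by
        refine ⟨(x₀ :: x₁ :: v :: x₃ :: A).length, ?_⟩
        rw [show x₀ :: x₁ :: v :: x₃ :: x₄ :: R = (x₀ :: x₁ :: v :: x₃ :: A) ++ [z] by simp [hA],
          rotate_append_length_eq]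
        rfl
      have hL2 : IsLoop (z :: x₀ :: x₁ :: v :: x₃ :: A) := by
        obtain ⟨n, hn⟩ := hrot2; exact hn ▸ hL.rotate n
      have hx₀ : x₁ + x₃ - v = x₀ := hv'.trans h0
      refine ⟨z :: x₀ :: x₃ :: A, bwd_isLoop hL2 hx₀, ?_, ?_, ?_⟩
      · intro hP
        rwa [cycTurn_bwd hL2 hab hx₀, cycTurn_eq_of_isRotated hrot2 hL.three_le, hcyc] at hP
      · left
        rw [← hlenL]
        have := congrArg List.length hA
        simp only [length_cons, length_append, length_nil] at this ⊢
        omega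
      · intro p hp
        apply hBL
        rw [hrot2.mem_iff]
        simp only [mem_cons] at hp ⊢
        tauto
    · by_cases h4 : v + dir 0 + dir 3 = x₄
      · -- forward shortcut
        left
        have hx₄ : x₁ + x₃ - v = x₄ := hv'.trans h4
        refine ⟨x₀ :: x₁ :: x₄ :: R, fwd_isLoop hL hx₄, ?_, ?_, ?_⟩
        · intro hP
          rwa [cycTurn_fwd hL hab hx₄, hcyc] at hP
        · left; rw [← hlenL]; simp
        · intro p hp
          apply hBL
          simp only [mem_cons] at hp ⊢
          tauto
      · -- move on along the diagonal
        right
        exact (cornerAt_next hL h13 hmem h0 h4).of_isRotated hrot.symm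
  · -- flip
    left
    rw [← hv'] at hmem
    refine ⟨x₀ :: x₁ :: (x₁ + x₃ - v) :: x₃ :: x₄ :: R, flip_isLoop hL hmem, ?_, ?_, ?_⟩
    · intro hP
      rwa [cycTurn_flip hL hab hmem, hcyc] at hP
    · right
      refine ⟨by rw [← hlenL]; simp, ?_⟩
      rw [← hhtL]
      simp only [height_cons, hv']
      have e : (v + dir 0 + dir 3).2 = v.2 - 1 := by simp [dir]; ring
      rw [e]
      omega
    · intro p hp
      simp only [mem_cons] at hp
      rcases hp with rfl | rfl | rfl | rfl | rfl | hp
      · exact hBL _ (by simp)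
      · exact hBL _ (by simp)
      · rw [hv']; simpa [dir] using hdown
      · exact hBL _ (by simp)
      · exact hBL _ (by simp)
      · exact hBL _ (by simp [hp])

/-- The diagonal points `q + k (e₀ - e₁)` are pairwise distinct. [folklore] -/
theorem diag_injective (q : ℤ × ℤ) : Function.Injective fun k : ℕ => q + (k : ℤ) • (dir 0 + dir 3) := by
  intro j k h
  have := congrArg Prod.fst h
  simp [dir] at this
  exact_mod_cast this

/-- **The rectilinear Umlaufsatz** (Hopf 1935, Satz I, for orthogonal lattice polygons): a
rectilinear lattice loop turns by `±4` quarter turns, i.e. by `±2π`. [cite: Hopf1935, Satz I] -/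
theorem IsLoop.cycTurn_eq {l : List (ℤ × ℤ)} (hl : IsLoop l) : cycTurn l = 4 ∨ cycTurn l = -4 := by
  -- a level below the loop
  obtain ⟨B, hB⟩ : ∃ B : ℤ, ∀ p ∈ l, B ≤ p.2 := by
    refine ⟨-(l.map fun p => |p.2|).sum, fun p hp => ?_⟩
    have h1 : |p.2| ≤ (l.map fun p => |p.2|).sum :=
      List.single_le_sum (fun x hx => by obtain ⟨y, -, rfl⟩ := mem_map.1 hx; exact abs_nonneg _) _
        (mem_map.2 ⟨p, hp, rfl⟩)
    have h2 : -|p.2| ≤ p.2 := neg_abs_le _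
    linarith
  suffices key : ∀ (n : ℕ) (h : ℕ) (l : List (ℤ × ℤ)), IsLoop l → l.length = n → height B l = h →
      (∀ p ∈ l, B ≤ p.2) → P l from key _ _ l hl rfl rfl hB
  intro n
  induction n using Nat.strong_induction_on with
  | _ n ihn =>
  intro h
  induction h using Nat.strong_induction_on with
  | _ h ihh =>
  intro l hl hlen hh hB
  rcases Nat.lt_or_ge n 5 with hsmall | h5
  · -- small loops
    have h3 := hl.three_le
    match l, hlen, h3 with
    | [a, b, c], _, _ => exact absurd hl (not_isLoop_three a b c)
    | [a, b, c, d], _, _ => exact cycTurn_four hl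
    | a :: b :: c :: d :: e :: r, hlen, _ => simp at hlen; omega
  · -- the walk along the diagonal from the top-left vertex
    obtain ⟨q, hq, htop⟩ := exists_topleft (l := l) (by rintro rfl; simp at hlen; omega)
    have hc0 : CornerAt l q := cornerAt_topleft hl (hlen ▸ h5) hq htop
    have walk : ∀ k : ℕ, (∃ l', IsLoop l' ∧ (P l' → P l) ∧
        (l'.length + 2 = l.length ∨ (l'.length = l.length ∧ height B l' < height B l)) ∧
        ∀ p ∈ l', B ≤ p.2) ∨ ∀ j ≤ k, CornerAt l (q + (j : ℤ) • (dir 0 + dir 3)) := by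
      intro k
      induction k with
      | zero => right; intro j hj; obtain rfl : j = 0 := Nat.le_zero.1 hj; simpa using hc0
      | succ k ih =>
        rcases ih with good | hall
        · exact Or.inl good
        · rcases exists_move_or_cornerAt hl (hall k le_rfl) B hB with good | hnext
          · exact Or.inl good
          · right
            intro j hj
            rcases Nat.lt_or_ge j (k + 1) with hlt | hge
            · exact hall j (by omega)
            · obtain rfl : j = k + 1 := le_antisymm hj hge
              have e : q + ((k + 1 : ℕ) : ℤ) • (dir 0 + dir 3) = q + (k : ℤ) • (dir 0 + dir 3) + dir 0 + dir 3 := by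
                push_cast
                rw [add_smul, one_smul]
                abel
              rw [e]
              exact hnext
    rcases walk n with ⟨l', hl', himp, hμ, hB'⟩ | hall
    · apply himp
      rcases hμ with hlt | ⟨heq, hht⟩
      · exact ihn l'.length (by omega) (height B l') l' hl' rfl rfl hB'
      · exact ihh (height B l') (by omega) l' hl' (by omega) rfl hB'
    · -- pigeonhole: `n + 1` distinct diagonal points in a list of length `n`
      exfalso
      have hsub : ((range (n + 1)).map fun k : ℕ => q + (k : ℤ) • (dir 0 + dir 3)) <+~ l := by
        refine subperm_of_subset ((nodup_range).map (diag_injective q)) fun x hx => ?_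
        obtain ⟨k, hk, rfl⟩ := mem_map.1 hx
        exact (hall k (by simpa [Nat.lt_succ_iff] using hk)).mem
      have := hsub.length_le
      simp only [length_map, length_range] at this
      omega

end RectLoop

end Literature.Topology.PlaneTopology
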